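import Summits.QuantumFields.BalabanUV.Beta.GAN24.CombesThomas

/-!
# `BalabanUV.Beta.GAN24.StencilSlotSupRate` — binder row G-an2-4 / (CONV-C), S-slot: the DRIFT shape of a stencil family needs NO
# off-diagonal input beyond its uniform locality — «E3Drift» ⇐ «E3Shape» ∧ a plain ONE-STEP SUP-NORM rate (the King (4.38) interpolation,
# `GAN24/CombesThomas` §1, transposed from `Decays` to an2's `LocStencil`/`BiLoc`; FINDING F-gan24p1-3 = the stencil twin of F-gan24p1-1)

NOT IN PRINT; OUR PROOF ATTEMPT (row owner b2b-balaban-gan24-p1, gen 3; note `HOME/b2b-balaban-gan24-p1/SKELETON-S3.md` §8 (I-L8)).  HONEST FRAMING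
(cell contract, verbatim): «discharging `BetaPertH` makes Bałaban's UV stability UNCONDITIONAL — a real constructive-QFT result; it is NOT the continuum
limit and NOT the Clay problem.»  HONEST DEPENDENCY (verbatim): «continuum YM on T⁴ ⇐ BetaPertH ∧ nine spine estimates (0/9 proved); BetaPertH ⇐ (D1) ∧
(D4) ∧ CAP+tail; G-an2-4 gates asym, D1 and NE2/3/4.»  [folklore] real analysis: `min ≤ geometric mean` (`King1986.abs_le_sqrt_mul_exp_half` BY NAME) +
the geometric series (`CombesThomas.supCauchy_of_supRate` BY NAME); no estimate on an2's objects, no cited fact, no `def`, no `Prop` mirror.  Every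
shape below is a HYPOTHESIS; nothing of the wall is discharged; 0 wall binders instantiated.  NOT summit progress.

## What is proved
* §1 generic (`MKer D F`, stencil families `Fin (d+1) → ℤ^{d+1} → MKer`): `biLoc_half_of_supBound` (bi-localised with constant `C` at rate `δ` and
  sup-bounded by `ε` ⇒ bi-localised with the SMALL constant `√(εC)` at rate `δ/2`), `biLoc_sub'`, `locStencil_half_of_supBound`, and
  **`locStencilCauchy_of_uniform_supRate`**: a family `F : ℕ → stencil family` with `∀ n, LocStencil (F n) C δ` and the one-step SUP-NORM rate
  `|F (n+1) κ u x y a b − F n κ u x y a b| ≤ c·θ^n` (`0 ≤ c`, `0 ≤ θ < 1`) satisfies the all-scales weighted Cauchy shape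
  `∀ k j, LocStencil (fun κ u ↦ F (k+j) κ u − F k κ u) (√(2(c/(1−θ))C)·(√θ)^k) (δ/2)` — rate `√θ`, half the locality rate, NO decay asked of the differences.
* §2 THE S-SLOT APPLICATION (generic `d`, units `sfStep`, `smStep d` BY NAME; `Ẽ n` := the normalised third-jet summand
  `unitS (sfStep Lc n) (smStep d Lc n) (fun κ u ↦ (cE * wE d Lc n) • e3Of d Lc cE cVH cΛ n κ u)`): **`e3Drift_of_shape_supRate`** —
  «E3Shape» (`∀ j, LocStencil (Ẽ (j+1)) C₃ δ₃`) ∧ «E3SupRate» (`∀ j κ u x y a b, |Ẽ (j+2) κ u x y a b − Ẽ (j+1) κ u x y a b| ≤ c·θ^j`) ⟹ «E3Drift» in EXACTLY the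
  member-pair shape consumed by `StencilSlotCauchyOfShapes.hSall_of_shapes` / `StencilSlotOfE3.hSall_of_e3`, with constant `√(2(c/(1−θ))C₃)`, rate `√θ`,
  locality `δ₃/2`.  So the located pair of the S-slot is «E3Shape» + a SUP-NORM one-step rate of the normalised third jet — road «S3-fibre²»'s L8 is a
  real-zone sup estimate, as (I2′) was for the K-slot.
-/

noncomputable section

open Literature.MathematicalPhysics.QuantumFieldTheory
open Literature.MathematicalPhysics.QuantumFieldTheory.Balaban1983to89
open Literature.MathematicalPhysics.QuantumFieldTheory.Balaban1983to89.Beta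
open B12Sec2to5 (l1 l1_nonneg)
open ExpKernelCalculus (MKer BiLoc)
open OneStepResolventKernel (Fib LocStencil)
open BalabanStepJetsSucc (wE e3Of)
open Summit.QuantumFields.BalabanUV.Beta.HessKerDressedUnits (unitS)
open Summit.QuantumFields.BalabanUV.Beta.GAN24.CombesThomas (SupBound SupRate SupCauchy supCauchy_of_supRate sqrt_pow_eq sfStep smStep)

namespace Summit.QuantumFields.BalabanUV.Beta.GAN24.StencilSlotSupRate

/-! ## §1 Generic: bi-localisation + sup bound ⇒ small constant at half rate; uniform locality + sup rate ⇒ weighted Cauchy -/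

section Generic

variable {D : ℕ} {F : Type*}

/-- [folklore] **INTERPOLATION FOR BI-LOCALISED KERNELS**: `BiLoc K p q C δ` and `|K| ≤ ε` entrywise give `BiLoc K p q √(εC) (δ/2)`. -/
theorem biLoc_half_of_supBound {K : MKer D F} {p q : Fin D → ℤ} {C δ ε : ℝ} (h : BiLoc K p q C δ) (hε : 0 ≤ ε) (hsup : SupBound K ε) :
    BiLoc K p q (Real.sqrt (ε * C)) (δ / 2) := by
  intro x y a b
  have h2 := h x y a b
  rw [neg_mul] at h2
  have h3 := King1986.abs_le_sqrt_mul_exp_half hε (hsup x y a b) h2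
  rwa [← neg_mul] at h3

/-- [folklore] Difference of two kernels bi-localised at the same points (constants add). -/
theorem biLoc_sub' {K K' : MKer D F} {p q : Fin D → ℤ} {C C' δ : ℝ} (h : BiLoc K p q C δ) (h' : BiLoc K' p q C' δ) :
    BiLoc (K - K') p q (C + C') δ := by
  intro x y a b
  simp only [Pi.sub_apply]
  calc |K x y a b - K' x y a b| ≤ |K x y a b| + |K' x y a b| := abs_sub _ _
    _ ≤ _ := by rw [add_mul]; exact add_le_add (h x y a b) (h' x y a b)

end Generic

section Stencil

variable {d : ℕ}

/-- [folklore] The stencil-family form of the interpolation: `LocStencil S C δ` and an entrywise sup bound `ε` give `LocStencil S √(εC) (δ/2)`. -/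
theorem locStencil_half_of_supBound {S : Fin (d + 1) → (Fin (d + 1) → ℤ) → MKer (d + 1) (Fib d)} {C δ ε : ℝ}
    (h : LocStencil S C δ) (hε : 0 ≤ ε) (hsup : ∀ κ u, SupBound (S κ u) ε) : LocStencil S (Real.sqrt (ε * C)) (δ / 2) :=
  fun κ u => biLoc_half_of_supBound (h κ u) hε (hsup κ u)

/-- [folklore] **UNIFORM LOCALITY + ONE-STEP SUP-NORM RATE ⇒ THE WALL'S WEIGHTED CAUCHY SHAPE** for a family of stencil families
`F : ℕ → …` (`0 ≤ c`, `0 ≤ θ < 1`): `∀ k j, LocStencil (F (k+j) − F k) (√(2(c/(1−θ))C)·(√θ)^k) (δ/2)`.  No decay is asked of the differences. -/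
theorem locStencilCauchy_of_uniform_supRate {F : ℕ → Fin (d + 1) → (Fin (d + 1) → ℤ) → MKer (d + 1) (Fib d)} {C δ c θ : ℝ}
    (hS : ∀ n, LocStencil (F n) C δ) (hR : ∀ n κ u, SupBound (F (n + 1) κ u - F n κ u) (c * θ ^ n)) (hc : 0 ≤ c) (hθ0 : 0 ≤ θ)
    (hθ1 : θ < 1) (k j : ℕ) :
    LocStencil (fun κ u => F (k + j) κ u - F k κ u) (Real.sqrt (2 * (c / (1 - θ)) * C) * Real.sqrt θ ^ k) (δ / 2) := by
  intro κ u
  -- sup-norm Cauchy bound for the entry family `n ↦ F n κ u`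
  have hsc : SupCauchy (fun n => F n κ u) (c / (1 - θ)) θ := supCauchy_of_supRate (fun n => hR n κ u) hc hθ0 hθ1
  have hsup : SupBound (F (k + j) κ u - F k κ u) (c / (1 - θ) * θ ^ k) := hsc k j
  -- locality of the difference with the crude constant 2C
  have hloc : BiLoc (F (k + j) κ u - F k κ u) u u (C + C) δ := biLoc_sub' (hS (k + j) κ u) (hS k κ u)
  have hε : 0 ≤ c / (1 - θ) * θ ^ k := mul_nonneg (div_nonneg hc (by linarith)) (pow_nonneg hθ0 k)
  have h := biLoc_half_of_supBound hloc hε hsup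
  have e : Real.sqrt (c / (1 - θ) * θ ^ k * (C + C)) = Real.sqrt (2 * (c / (1 - θ)) * C) * Real.sqrt θ ^ k := by
    rw [show c / (1 - θ) * θ ^ k * (C + C) = (2 * (c / (1 - θ)) * C) * θ ^ k by ring, Real.sqrt_mul' _ (pow_nonneg hθ0 k),
      sqrt_pow_eq hθ0]
  rw [e] at h
  exact h

end Stencil

/-! ## §2 The S-slot application: «E3Drift» from «E3Shape» and a sup-norm one-step rate of the normalised third jet -/

section E3

variable {d : ℕ} {Lc : ℕ} [NeZero Lc]

/-- **«E3Drift» ⇐ «E3Shape» ∧ «E3SupRate»** [folklore]: if the normalised third-jet summands `Ẽ (j+1)` of an2's composites are `j`-uniformly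
local (`C₃`, `δ₃`) and converge at a one-step SUP-NORM rate `c·θ^j` (`0 ≤ c`, `0 ≤ θ < 1`; no decay asked), then the member-pair drift shape of
`StencilSlotCauchyOfShapes.hSall_of_shapes` holds with constant `√(2(c/(1−θ))C₃)·(√θ)^k` at locality rate `δ₃/2`. -/
theorem e3Drift_of_shape_supRate {cE cVH cΛ C₃ δ₃ c θ : ℝ}
    (hE3 : ∀ j : ℕ, LocStencil (unitS (sfStep Lc (j + 1)) (smStep d Lc (j + 1))
      (fun κ u => (cE * wE d Lc (j + 1)) • e3Of d Lc cE cVH cΛ (j + 1) κ u)) C₃ δ₃)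
    (hR : ∀ (j : ℕ) (κ : Fin (d + 1)) (u : Fin (d + 1) → ℤ),
      SupBound (unitS (sfStep Lc (j + 2)) (smStep d Lc (j + 2)) (fun κ u => (cE * wE d Lc (j + 2)) • e3Of d Lc cE cVH cΛ (j + 2) κ u) κ u -
        unitS (sfStep Lc (j + 1)) (smStep d Lc (j + 1)) (fun κ u => (cE * wE d Lc (j + 1)) • e3Of d Lc cE cVH cΛ (j + 1) κ u) κ u) (c * θ ^ j))
    (hc : 0 ≤ c) (hθ0 : 0 ≤ θ) (hθ1 : θ < 1) (k j : ℕ) :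
    LocStencil (fun κ u =>
        unitS (sfStep Lc (k + j + 1)) (smStep d Lc (k + j + 1))
            (fun κ u => (cE * wE d Lc (k + j + 1)) • e3Of d Lc cE cVH cΛ (k + j + 1) κ u) κ u -
          unitS (sfStep Lc (k + 1)) (smStep d Lc (k + 1))
            (fun κ u => (cE * wE d Lc (k + 1)) • e3Of d Lc cE cVH cΛ (k + 1) κ u) κ u)
      (Real.sqrt (2 * (c / (1 - θ)) * C₃) * Real.sqrt θ ^ k) (δ₃ / 2) := by
  have h := locStencilCauchy_of_uniform_supRate
    (F := fun n κ u => unitS (sfStep Lc (n + 1)) (smStep d Lc (n + 1))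
      (fun κ u => (cE * wE d Lc (n + 1)) • e3Of d Lc cE cVH cΛ (n + 1) κ u) κ u)
    (fun n => hE3 n) (fun n κ u => hR n κ u) hc hθ0 hθ1 k j
  simpa only [Nat.add_right_comm] using h

end E3

end Summit.QuantumFields.BalabanUV.Beta.GAN24.StencilSlotSupRate

end
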